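import Summits.NavierStokesRegularity.NavierStokesRegularity.Theses.AxisymmetricExtremality
import Summits.NavierStokesRegularity.NavierStokesRegularity.Theorems.AxisymmetricExtremalityAxisymmetricKatoGlobalStubSereginLogSwirlOriginStep3LocalIntegrated
import Summits.NavierStokesRegularity.NavierStokesRegularity.Theorems.AxisymmetricExtremalityAxisymmetricKatoGlobalStubSereginLogSwirlOriginStep3Absorb
import HarnessLib

/-!
# Seregin 2022, §2 Step 3 for the LOCAL smooth class (VI): absorption of `B₃` and the
# a-priori inequality behind the key estimate, for a family of smooth axisymmetric fields
# solving the vorticity equation near the cut-off — crux stmt-NavierStokesRegularity-15453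
# (`AxisymmetricExtremality.AxisymmetricKatoGlobal`), line registered, support for stub `stub_sereginLogSwirlOrigin`

Support file (`--supports stmt-NavierStokesRegularity-15453`; theorems only, everything proved)
toward the registered stub `stub_sereginLogSwirlOrigin` = the named fact
`Literature.Analysis.FluidPDE.seregin2022_logSwirl_regularAtOrigin` (G. Seregin, J. Math. Fluid
Mech. 24 (2022), Paper 27 = arXiv:2201.00153, §2). The sibling `…Step3Absorb` proves the
a-priori inequality of Step 3 (arXiv p. 7: "Combining all the estimates made on this step, we
shall have `½∂ₜ∫(Φη³)² + (Γη³)² + ∫(η³|∇Φ|)² + (η³|∇Γ|)² ≤ …`") for a whole-space classical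
solution `IsClassicalNSSolutionOn (Ioo T₀ T₁) ν 0 v q`. This file proves the same inequality —
same conclusion, same constants — for the input actually available after the first-singular-time
reduction of the fact: a family `v` of globally `C^∞` axisymmetric fields on the open slab
(a cut-off globalisation `χV` of the Seregin–Zajaczkowski representative) which, on an open set
`W` containing the compact `K` off which the cut-off `ζ = η³` vanishes, is divergence free and
solves the VORTICITY equation pointwise off the axis
(`d/ds curl (v s) x = νΔω − Dω[v] + Dv[ω]`, `…Step3LocalClass`), with the time regularity that
class has: `Γ = ω_θ/r`, `Φ = ω_r/r`, their gradients and the quotients `angVelQuot W`,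
`radVelQuot W` of the vorticity right-hand side `W` jointly continuous on the slab (hypotheses;
for `χV` they follow from the joint continuity of the spatial derivatives of `V`).

* `integral_cutoff_sq_sub_eq_of_ae_on` — the energy balance `E(t₂) − E(t₁) = ∫_{t₁}^{t₂}(…)` of
  `…Step3LocalBalance` with the a.e. time derivative required only on `W ⊇ K` (Urysohn `θ`);
* `continuousOn_integral_gradSq_cutoff_of_continuousOn` — continuity in time of the localised
  dissipation `∫|∇(ζG)|²` from joint continuity of `G`, `D_xG`;
* `cutoff_energy_apriori_local` (registered sub-goal) — **the a-priori inequality of Step 3 for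
  the local class**: with `E = ∫(ζΓ)² + ∫(ζΦ)²`, `D = ∫|∇(ζΓ)|² + ∫|∇(ζΦ)|²`, the hypotheses (2.2)
  (`|σ| ≤ C₁/ln³(e/r)`, `r < r₁`), the far-field bound `M`, the cut-off bound `Bcut` and the
  `A₃`-bound `2A₃ ≤ θ_A D + B_A` exactly as in `cutoff_energy_apriori`, for `t ∈ [t₁, t₂]`:
  `E(t) + (2ν − 8C₁/ln(e/r₁) − θ_A)∫_{t₁}^t D ≤ E(t₁) + (Bcut + B_A + 4M|B(0,2)|)(t − t₁)`
  (the fixed-time inequalities `…_cutoff_energy_le_local`, whose `∂ₜ`-terms `∫ζ²Γ(angVelQuot W)`,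
  `∫ζ²Φ(radVelQuot W)` ARE the densities of the balances by `hasDerivAt_angVortQuot_of_ne`,
  `hasDerivAt_radVelQuot_curl_of_ne` off the Lebesgue-null axis; `B₃` by
  `abs_integral_angVelQuot_mul_mul_le` = (2.2) + Lemma 2.2);
* `cutoff_energy_keyEstimate_local` (registered sub-goal) — **the key estimate for the local
  class** under the smallness `8C₁/ln(e/r₁) + θ_A < 2ν`: `sup_{[t₁,t₂]} E ≤ K₀`,
  `∫_{t₁}^{t₂} D ≤ K₀/(2ν − 8C₁/ln(e/r₁) − θ_A)`, `K₀ = E(t₁) + (Bcut + B_A + 4M|B(0,2)|)(t₂ − t₁)`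
  — verbatim the conclusion of `cutoff_energy_keyEstimate`.

## Mathlib / tree search

Tree: `cutoff_energy_apriori`, `cutoff_energy_keyEstimate`, `integral_horizontal_gradSq_le`
(`…Step3Absorb`), `abs_integral_angVelQuot_mul_mul_le`, `log_exp_div_eq` (`…Step3SwirlSource`),
`integral_cutoff_sq_sub_eq_of_ae` (`…Step3LocalBalance`), `angVortQuot_cutoff_energy_le_local`,
`radVelQuot_curl_cutoff_energy_le_local` (`…Step3LocalIntegrated`), `hasDerivAt_angVortQuot_of_ne`,
`hasDerivAt_radVelQuot_curl_of_ne`, `contDiff_vorticityRHS`, `isAxisymmetric_vorticityRHS`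
(`…Step3LocalEquations(Phi)`), `volume_axis_eq_zero` (`AxisymWeights`),
`exists_contDiff_one_nhdsSet_zero_nhdsSet`, `fderiv_eq_zero_of_forall_notMem`,
`fderiv_mul_apply_of_differentiableAt`, `continuousOn_integral_cutoff`.
`lean search 'apriori_local|keyEstimate_local' --decl`: no matches (2026-08-17).

## References

* G. Seregin, J. Math. Fluid Mech. 24 (2022), Paper No. 27 = arXiv:2201.00153, §2 Step 3
  (arXiv p. 7, the a-priori inequality and the key estimate). [`Seregin2022LocalAxisym`]
-/

noncomputable section

open MeasureTheory Set Filter Topology Function Metric intervalIntegral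
open scoped ENNReal ContDiff Laplacian
open Literature.Analysis.FluidPDE

-- `<Problem> = <Summit>` duplicates a namespace component by design (lakefile sets the same option).
set_option linter.dupNamespace false

namespace Summit.NavierStokesRegularity.NavierStokesRegularity.Theorems.AxisymmetricKatoGlobal.EulerScaling

/-! ### Tools: localised balance, continuity of the dissipation, the axis is null -/

section Tools

variable {S : Set ℝ} {ζ G G' : ℝ → EuclideanSpace ℝ (Fin 3) → ℝ} {K W : Set (EuclideanSpace ℝ (Fin 3))}

/-- **The weighted energy balance with the a.e. time derivative required only near the cut-off**:
`integral_cutoff_sq_sub_eq_of_ae` with its hypothesis `d/ds G(s, x) = G'(s, x)` (a.e. `x`)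
weakened to a.e. `x ∈ W`, `W` an open neighbourhood of the compact `K` off which `ζ` vanishes
(apply the sibling to `θG`, `θG'` for a smooth Urysohn `θ`; each integrand carries a factor `ζ`).
[cite: Seregin2022LocalAxisym, §2 Step 3 (arXiv:2201.00153 p. 7, integration in time of the key differential inequality)] -/
theorem integral_cutoff_sq_sub_eq_of_ae_on (hS : IsOpen S) (hζ : IsSmoothSpaceTimeOn S ζ)
    (hK : IsCompact K) (hsupp : ∀ t ∈ S, ∀ x ∉ K, ζ t x = 0) (hW : IsOpen W) (hKW : K ⊆ W)
    (hG : ContinuousOn (uncurry G) (S ×ˢ univ)) (hG' : ContinuousOn (uncurry G') (S ×ˢ univ))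
    (hder : ∀ᵐ x ∂(volume : Measure (EuclideanSpace ℝ (Fin 3))), x ∈ W → ∀ s ∈ S,
      HasDerivAt (fun s' => G s' x) (G' s x) s)
    {t₁ t₂ : ℝ} (h12 : t₁ ≤ t₂) (hsub : Icc t₁ t₂ ⊆ S) :
    ContinuousOn (fun t => 2 * (∫ x, ζ t x * timeDerivWithin S ζ t x * G t x ^ 2) +
        2 * ∫ x, ζ t x ^ 2 * G t x * G' t x) S ∧
    (∫ x, (ζ t₂ x * G t₂ x) ^ 2) - ∫ x, (ζ t₁ x * G t₁ x) ^ 2 =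
      ∫ t in t₁..t₂, (2 * (∫ x, ζ t x * timeDerivWithin S ζ t x * G t x ^ 2) +
        2 * ∫ x, ζ t x ^ 2 * G t x * G' t x) := by
  obtain ⟨θ, hθ, hθ1, hθ0⟩ := exists_contDiff_one_nhdsSet_zero_nhdsSet hK hW hKW
  have hθK : ∀ x ∈ K, θ x = 1 := fun x hx => hθ1.self_of_nhdsSet x hx
  have hθW : ∀ x ∉ W, θ x = 0 := fun x hx => hθ0.self_of_nhdsSet x hx
  have eE : ∀ s ∈ S, ∀ y, ζ s y * (θ y * G s y) = ζ s y * G s y := by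
    intro s hs y
    by_cases hy : y ∈ K
    · rw [hθK y hy, one_mul]
    · simp [hsupp s hs y hy]
  have e0 : ∀ s ∈ S, ∀ x, ζ s x * timeDerivWithin S ζ s x * (θ x * G s x) ^ 2 =
      ζ s x * timeDerivWithin S ζ s x * G s x ^ 2 := by
    intro s hs x
    by_cases hx : x ∈ K
    · rw [hθK x hx, one_mul]
    · simp [hsupp s hs x hx]
  have e5 : ∀ s ∈ S, ∀ x, ζ s x ^ 2 * (θ x * G s x) * (θ x * G' s x) = ζ s x ^ 2 * G s x * G' s x := by
    intro s hs x
    by_cases hx : x ∈ K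
    · rw [hθK x hx, one_mul, one_mul]
    · simp [hsupp s hs x hx]
  have hGt : ContinuousOn (uncurry fun s x => θ x * G s x) (S ×ˢ univ) :=
    ((hθ.continuous.comp continuous_snd).continuousOn.mul hG).congr fun z _ => rfl
  have hG't : ContinuousOn (uncurry fun s x => θ x * G' s x) (S ×ˢ univ) :=
    ((hθ.continuous.comp continuous_snd).continuousOn.mul hG').congr fun z _ => rfl
  have hdert : ∀ᵐ x ∂(volume : Measure (EuclideanSpace ℝ (Fin 3))), ∀ s ∈ S,
      HasDerivAt (fun s' => θ x * G s' x) (θ x * G' s x) s := by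
    filter_upwards [hder] with x hx s hs
    by_cases hxW : x ∈ W
    · exact (hx hxW s hs).const_mul (θ x)
    · simp only [hθW x hxW, zero_mul]
      exact hasDerivAt_const s 0
  obtain ⟨hdens, hbal⟩ := integral_cutoff_sq_sub_eq_of_ae hS hζ hK hsupp hGt hG't hdert h12 hsub
  refine ⟨hdens.congr fun t ht => ?_, ?_⟩
  · simp only [e0 t ht, e5 t ht]
  · have hI : ∀ t ∈ uIcc t₁ t₂, t ∈ S := fun t ht => hsub (by rwa [uIcc_of_le h12] at ht)
    simp only [eE t₁ (hsub ⟨le_rfl, h12⟩), eE t₂ (hsub ⟨h12, le_rfl⟩)] at hbal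
    rw [hbal]
    exact intervalIntegral.integral_congr fun t ht => by simp only [e0 t (hI t ht), e5 t (hI t ht)]

/-- **Continuity in time of the localised dissipation `∫|∇(ζG)|²`** for `ζ` jointly smooth on the
open `S` vanishing off the compact `K` and `G` with differentiable slices, `G` and `(t, x) ↦ D(G t)(x)`
jointly continuous (`D(ζG) = ζDG + GDζ`). [folklore] -/
theorem continuousOn_integral_gradSq_cutoff_of_continuousOn (hS : IsOpen S) (hζ : IsSmoothSpaceTimeOn S ζ)
    (hK : IsCompact K) (hsupp : ∀ t ∈ S, ∀ x ∉ K, ζ t x = 0)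
    (hG : ContinuousOn (uncurry G) (S ×ˢ univ)) (hGd : ∀ t ∈ S, Differentiable ℝ (G t))
    (hDG : ContinuousOn (fun z : ℝ × EuclideanSpace ℝ (Fin 3) => fderiv ℝ (G z.1) z.2) (S ×ˢ univ)) :
    ContinuousOn (fun t => ∫ x,
      (fderiv ℝ (fun y => ζ t y * G t y) x (EuclideanSpace.single 0 1) ^ 2 +
        fderiv ℝ (fun y => ζ t y * G t y) x (EuclideanSpace.single 1 1) ^ 2 +
        fderiv ℝ (fun y => ζ t y * G t y) x (EuclideanSpace.single 2 1) ^ 2)) S := by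
  have hU : UniqueDiffOn ℝ S := hS.uniqueDiffOn
  have hζc : ContinuousOn (uncurry ζ) (S ×ˢ univ) := hζ.continuousOn
  have hζi : ∀ i : Fin 3, ContinuousOn (uncurry fun s x => fderiv ℝ (ζ s) x (EuclideanSpace.single i 1))
      (S ×ˢ univ) := fun i => (hζ.fderiv_slice_apply hU _).continuousOn
  have hGi : ∀ i : Fin 3, ContinuousOn (fun z : ℝ × EuclideanSpace ℝ (Fin 3) =>
      fderiv ℝ (G z.1) z.2 (EuclideanSpace.single i 1)) (S ×ˢ univ) := fun i =>
    hDG.clm_apply continuousOn_const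
  have hζsd : ∀ t ∈ S, Differentiable ℝ (ζ t) := fun t ht =>
    (hζ.contDiff_slice ht).differentiable (by simp)
  have hDi : ∀ i : Fin 3, ContinuousOn (uncurry fun s x =>
      fderiv ℝ (fun y => ζ s y * G s y) x (EuclideanSpace.single i 1)) (S ×ˢ univ) := by
    intro i
    refine ((hζc.mul (hGi i)).add (hG.mul (hζi i))).congr fun z hz => ?_
    exact fderiv_mul_apply_of_differentiableAt (hζsd z.1 hz.1 z.2) (hGd z.1 hz.1 z.2) _
  have hP0 : ∀ s ∈ S, ∀ x ∉ K, ζ s x * G s x = 0 := fun s hs x hx => by simp [hsupp s hs x hx]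
  have h := (((hDi 0).pow 2).add ((hDi 1).pow 2)).add ((hDi 2).pow 2)
  refine continuousOn_integral_cutoff (Ψ := fun t x =>
    fderiv ℝ (fun y => ζ t y * G t y) x (EuclideanSpace.single 0 1) ^ 2 +
      fderiv ℝ (fun y => ζ t y * G t y) x (EuclideanSpace.single 1 1) ^ 2 +
      fderiv ℝ (fun y => ζ t y * G t y) x (EuclideanSpace.single 2 1) ^ 2) hK
    (h.congr fun z _ => by simp only [uncurry, Pi.add_apply, Pi.pow_apply]) fun t ht x hx => ?_
  have h0 : fderiv ℝ (fun y => ζ t y * G t y) x = 0 :=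
    fderiv_eq_zero_of_forall_notMem hK.isClosed (hP0 t ht) hx
  simp [h0]

/-- Almost every point of `ℝ³` is off the axis (`volume_axis_eq_zero`). [folklore] -/
theorem ae_cylRadius_ne_zero' : ∀ᵐ x ∂(volume : Measure (EuclideanSpace ℝ (Fin 3))), cylRadius x ≠ 0 := by
  rw [ae_iff]
  refine measure_mono_null (fun y hy => ?_) volume_axis_eq_zero
  have hy' : cylRadius y = 0 := not_not.1 hy
  rw [cylRadius_eq_zero_iff] at hy'
  show y 0 ^ 2 + y 1 ^ 2 = 0
  simp [hy'.1, hy'.2]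

end Tools

/-! ### The a-priori inequality and the key estimate for the local class -/

section Apriori

set_option maxHeartbeats 800000 in
/-- **Seregin 2022, §2 Step 3 — the a-priori inequality behind the key estimate, for the LOCAL
smooth class** (arXiv p. 7: "Combining all the estimates made on this step, we shall have
`½∂ₜ∫(Φη³)² + (Γη³)² + ∫(η³|∇Φ|)² + (η³|∇Γ|)² ≤ (cC₁/ln(e/r₁) + cC₁²/ln⁴(e/r₁))‖η³∇Γ‖‖η³∇Φ‖ + …`").
The statement of `cutoff_energy_apriori` with the classical solution replaced by: a family `v`
of globally `C^∞` axisymmetric fields on the open slab `(T₀, T₁)`, a compact `K` off which the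
cut-off `ζ = η³` vanishes and an open `W ⊇ K` on which `div v = 0` and the vorticity equation
holds pointwise off the axis (`d/ds curl (v s) x = νΔω − Dω[v] + Dv[ω]`), and joint continuity on
the slab of `Γ`, `DΓ`, `angVelQuot W` and `Φ`, `DΦ`, `radVelQuot W` (`W` the vorticity right-hand
side). Conclusion, hypotheses (2.2)/`M`/`Bcut`/`θ_A, B_A` and constants verbatim as there:
`E(t) + (2ν − 8C₁/ln(e/r₁) − θ_A)∫_{t₁}^t D ≤ E(t₁) + (Bcut + B_A + 4M|B(0,2)|)(t − t₁)` for
`t ∈ [t₁, t₂]`. Registered sub-goal toward `stub_sereginLogSwirlOrigin`.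
[cite: Seregin2022LocalAxisym, §2 Step 3 (arXiv:2201.00153 p. 7, "Combining all the estimates made on this step")] -/
theorem cutoff_energy_apriori_local : ∀ (T₀ T₁ ν : ℝ) (v : ℝ → EuclideanSpace ℝ (Fin 3) → EuclideanSpace ℝ (Fin 3)) (ζ : ℝ → EuclideanSpace ℝ (Fin 3) → ℝ) (K W : Set (EuclideanSpace ℝ (Fin 3))) (t₁ t₂ C₁ r₁ M θA BA Bcut : ℝ), (∀ s ∈ Ioo T₀ T₁, ContDiff ℝ (⊤ : ℕ∞) (v s)) → (∀ s ∈ Ioo T₀ T₁, IsAxisymmetric (v s)) → 0 ≤ ν → IsSmoothSpaceTimeOn (Ioo T₀ T₁) ζ → (∀ s ∈ Ioo T₀ T₁, IsAxisymmetricScalar (ζ s)) → (∀ s ∈ Ioo T₀ T₁, tsupport (ζ s) ⊆ SereginSverak2009.spaceCyl 0 1) → Icc t₁ t₂ ⊆ Ioo T₀ T₁ → IsCompact K → (∀ s ∈ Ioo T₀ T₁, ∀ x ∉ K, ζ s x = 0) → IsOpen W → K ⊆ W → (∀ s ∈ Ioo T₀ T₁, ∀ x ∈ W, VectorCalculus.divergence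 (v s) x = 0) → (∀ s ∈ Ioo T₀ T₁, ∀ x ∈ W, cylRadius x ≠ 0 → HasDerivAt (fun s' => curl (v s') x) (ν • (Δ (curl (v s))) x - fderiv ℝ (curl (v s)) x (v s x) + fderiv ℝ (v s) x (curl (v s) x)) s) → ContinuousOn (fun z : ℝ × EuclideanSpace ℝ (Fin 3) => angVortQuot (v z.1) z.2) (Ioo T₀ T₁ ×ˢ univ) → ContinuousOn (fun z : ℝ × EuclideanSpace ℝ (Fin 3) => angVelQuot (fun y => ν • (Δ (curl (v z.1))) y - fderiv ℝ (curl (v z.1)) y (v z.1 y) + fderiv ℝ (v z.1) y (curl (v z.1) y)) z.2) (Ioo T₀ T₁ ×ˢ univ) → ContinuousOn (fun z : ℝ × EuclideanSpace ℝ (Fin 3) => fderiv ℝ (angVortQuot (v z.1)) z.2) (Ioo T₀ T₁ ×ˢ univ) → ContinuousOn (fun z : ℝ × EuclideanSpace ℝ (Fin 3) => radVelQuot (curl (v z.1)) z.2) (Ioo T₀ T₁ ×ˢ univ) → ContinuousOn (fun z : ℝ × EuclideanSpace ℝ (Fin 3) => radVelQuot (fun y => ν • (Δ (curl (v z.1)))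 y - fderiv ℝ (curl (v z.1)) y (v z.1 y) + fderiv ℝ (v z.1) y (curl (v z.1) y)) z.2) (Ioo T₀ T₁ ×ˢ univ) → ContinuousOn (fun z : ℝ × EuclideanSpace ℝ (Fin 3) => fderiv ℝ (radVelQuot (curl (v z.1))) z.2) (Ioo T₀ T₁ ×ˢ univ) → 0 ≤ C₁ → 0 < r₁ → r₁ < 1 → 0 ≤ M → (∀ t ∈ Icc t₁ t₂, ∀ x, 0 < cylRadius x → cylRadius x < r₁ → |swirl (v t) x| ≤ C₁ / Real.log (Real.exp 1 / cylRadius x) ^ 3) → (∀ t ∈ Icc t₁ t₂, ∀ x, r₁ ≤ cylRadius x → |angVelQuot (v t) x * (ζ t x * angVortQuot (v t) x) * (ζ t x * radVelQuot (curl (v t)) x)| ≤ M) → (∀ t ∈ Icc t₁ t₂, (2 * (∫ x, ζ t x * timeDerivWithin (Ioo T₀ T₁) ζ t x * angVortQuot (v t) x ^ 2) + 2 * (∫ x, ζ t x * angVortQuot (v t) x ^ 2 * fderiv ℝ (ζ t) x (v t x)) + 2 * ν * (∫ x, angVortQuot (v t) x ^ 2 * (fderiv ℝ (ζ t) x (EuclideanSpace.single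 0 1) ^ 2 + fderiv ℝ (ζ t) x (EuclideanSpace.single 1 1) ^ 2 + fderiv ℝ (ζ t) x (EuclideanSpace.single 2 1) ^ 2)) - 4 * ν * (∫ x, ζ t x * angVortQuot (v t) x ^ 2 * radDerivQuot (ζ t) x)) + (2 * (∫ x, ζ t x * timeDerivWithin (Ioo T₀ T₁) ζ t x * radVelQuot (curl (v t)) x ^ 2) + 2 * (∫ x, ζ t x * radVelQuot (curl (v t)) x ^ 2 * fderiv ℝ (ζ t) x (v t x)) + 2 * ν * (∫ x, radVelQuot (curl (v t)) x ^ 2 * (fderiv ℝ (ζ t) x (EuclideanSpace.single 0 1) ^ 2 + fderiv ℝ (ζ t) x (EuclideanSpace.single 1 1) ^ 2 + fderiv ℝ (ζ t) x (EuclideanSpace.single 2 1) ^ 2)) - 4 * ν * (∫ x, ζ t x * radVelQuot (curl (v t)) x ^ 2 * radDerivQuot (ζ t) x)) ≤ Bcut) → (∀ t ∈ Icc t₁ t₂, 2 * (∫ x, ζ t x ^ 2 * radVelQuot (curl (v t)) x * fderiv ℝ (radVelQuot (v t)) x (curl (v t) x)) ≤ θA * ((∫ x, (fderiv ℝ (fun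 y => ζ t y * angVortQuot (v t) y) x (EuclideanSpace.single 0 1) ^ 2 + fderiv ℝ (fun y => ζ t y * angVortQuot (v t) y) x (EuclideanSpace.single 1 1) ^ 2 + fderiv ℝ (fun y => ζ t y * angVortQuot (v t) y) x (EuclideanSpace.single 2 1) ^ 2)) + (∫ x, (fderiv ℝ (fun y => ζ t y * radVelQuot (curl (v t)) y) x (EuclideanSpace.single 0 1) ^ 2 + fderiv ℝ (fun y => ζ t y * radVelQuot (curl (v t)) y) x (EuclideanSpace.single 1 1) ^ 2 + fderiv ℝ (fun y => ζ t y * radVelQuot (curl (v t)) y) x (EuclideanSpace.single 2 1) ^ 2))) + BA) → ∀ t ∈ Icc t₁ t₂, (∫ x, (ζ t x * angVortQuot (v t) x) ^ 2) + (∫ x, (ζ t x * radVelQuot (curl (v t)) x) ^ 2) + (2 * ν - 8 * C₁ / Real.log (Real.exp 1 / r₁) - θA) * ∫ s in t₁..t, ((∫ x, (fderiv ℝ (fun y => ζ s y * angVortQuot (v s) y) x (EuclideanSpace.single 0 1) ^ 2 + fderiv ℝ (fun y => ζ s y * angVortQuot (v s) y) x (EuclideanSpace.single 1 1) ^ 2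 + fderiv ℝ (fun y => ζ s y * angVortQuot (v s) y) x (EuclideanSpace.single 2 1) ^ 2)) + (∫ x, (fderiv ℝ (fun y => ζ s y * radVelQuot (curl (v s)) y) x (EuclideanSpace.single 0 1) ^ 2 + fderiv ℝ (fun y => ζ s y * radVelQuot (curl (v s)) y) x (EuclideanSpace.single 1 1) ^ 2 + fderiv ℝ (fun y => ζ s y * radVelQuot (curl (v s)) y) x (EuclideanSpace.single 2 1) ^ 2))) ≤ (∫ x, (ζ t₁ x * angVortQuot (v t₁) x) ^ 2) + (∫ x, (ζ t₁ x * radVelQuot (curl (v t₁)) x) ^ 2) + (Bcut + BA + 4 * M * volume.real (closedBall (0 : EuclideanSpace ℝ (Fin 3)) 2)) * (t - t₁) := by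
  intro T₀ T₁ ν v ζ K W t₁ t₂ C₁ r₁ M θA BA Bcut hu hax hν hζ hζax hζs hsub hK hsupp hWo hKW hdiv hvort hΓc hΓ'c hDΓc hJc hJ'c hDJc hC₁ hr₁ hr₁1 hM hσ hfar hcut hA3 t ht
  set S : Set ℝ := Ioo T₀ T₁ with hSdef
  have hS : IsOpen S := isOpen_Ioo
  have hv3 : ∀ s ∈ S, ContDiff ℝ 3 (v s) := fun s hs => (hu s hs).of_le (by norm_cast)
  have hW2 : ∀ s ∈ S, ContDiff ℝ 2 (fun y => ν • (Δ (curl (v s))) y - fderiv ℝ (curl (v s)) y (v s y) + fderiv ℝ (v s) y (curl (v s) y)) := fun s hs =>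
    (contDiff_vorticityRHS (hu s hs) ν).of_le (by norm_cast)
  have hWax : ∀ s ∈ S, IsAxisymmetric (fun y => ν • (Δ (curl (v s))) y - fderiv ℝ (curl (v s)) y (v s y) + fderiv ℝ (v s) y (curl (v s) y)) := fun s hs =>
    isAxisymmetric_vorticityRHS (hax s hs) ((hu s hs).of_le (by norm_cast)) ν
  -- name the two time-derivative families `Γ' = angVelQuot W`, `Φ' = radVelQuot W`
  obtain ⟨Γ', hΓ'def⟩ : ∃ Γ' : ℝ → EuclideanSpace ℝ (Fin 3) → ℝ, ∀ s x, Γ' s x = angVelQuot (fun y => ν • (Δ (curl (v s))) y - fderiv ℝ (curl (v s)) y (v s y) + fderiv ℝ (v s) y (curl (v s) y)) x :=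
    ⟨_, fun _ _ => rfl⟩
  obtain ⟨Φ', hΦ'def⟩ : ∃ Φ' : ℝ → EuclideanSpace ℝ (Fin 3) → ℝ, ∀ s x, Φ' s x = radVelQuot (fun y => ν • (Δ (curl (v s))) y - fderiv ℝ (curl (v s)) y (v s y) + fderiv ℝ (v s) y (curl (v s) y)) x :=
    ⟨_, fun _ _ => rfl⟩
  have hΓcU : ContinuousOn (uncurry fun s x => angVortQuot (v s) x) (S ×ˢ univ) := by
    rw [Function.uncurry_def]; exact hΓc
  have hJcU : ContinuousOn (uncurry fun s x => radVelQuot (curl (v s)) x) (S ×ˢ univ) := by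
    rw [Function.uncurry_def]; exact hJc
  have hΓ'cU : ContinuousOn (uncurry Γ') (S ×ˢ univ) := by
    have e : uncurry Γ' = fun z : ℝ × EuclideanSpace ℝ (Fin 3) => angVelQuot (fun y => ν • (Δ (curl (v z.1))) y - fderiv ℝ (curl (v z.1)) y (v z.1 y) + fderiv ℝ (v z.1) y (curl (v z.1) y)) z.2 := by
      funext z; exact hΓ'def z.1 z.2
    rw [e]; exact hΓ'c
  have hΦ'cU : ContinuousOn (uncurry Φ') (S ×ˢ univ) := by
    have e : uncurry Φ' = fun z : ℝ × EuclideanSpace ℝ (Fin 3) => radVelQuot (fun y => ν • (Δ (curl (v z.1))) y - fderiv ℝ (curl (v z.1)) y (v z.1 y) + fderiv ℝ (v z.1) y (curl (v z.1) y)) z.2 := by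
      funext z; exact hΦ'def z.1 z.2
    rw [e]; exact hJ'c
  -- the a.e. time derivatives of `Γ`, `Φ` off the axis, on `W`
  have hderΓ : ∀ᵐ x ∂(volume : Measure (EuclideanSpace ℝ (Fin 3))), x ∈ W → ∀ s ∈ S,
      HasDerivAt (fun s' => angVortQuot (v s') x) (Γ' s x) s := by
    filter_upwards [ae_cylRadius_ne_zero'] with x hx hxW s hs
    rw [hΓ'def]
    exact hasDerivAt_angVortQuot_of_ne hS hv3 hax hs hx (hW2 s hs) (hWax s hs) (hvort s hs x hxW hx)
  have hderJ : ∀ᵐ x ∂(volume : Measure (EuclideanSpace ℝ (Fin 3))), x ∈ W → ∀ s ∈ S,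
      HasDerivAt (fun s' => radVelQuot (curl (v s')) x) (Φ' s x) s := by
    filter_upwards [ae_cylRadius_ne_zero'] with x hx hxW s hs
    rw [hΦ'def]
    exact hasDerivAt_radVelQuot_curl_of_ne hS hv3 hax hs hx (hW2 s hs) (hWax s hs) (hvort s hs x hxW hx)
  have ht1S : Icc t₁ t ⊆ S := (Icc_subset_Icc_right ht.2).trans hsub
  -- the energy balances on `[t₁, t]`
  obtain ⟨hdensΓ, hbalΓ⟩ : ContinuousOn (fun s => 2 * (∫ x, ζ s x * timeDerivWithin S ζ s x * angVortQuot (v s) x ^ 2) +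
      2 * ∫ x, ζ s x ^ 2 * angVortQuot (v s) x * Γ' s x) S ∧
      (∫ x, (ζ t x * angVortQuot (v t) x) ^ 2) - (∫ x, (ζ t₁ x * angVortQuot (v t₁) x) ^ 2) =
        ∫ s in t₁..t, (2 * (∫ x, ζ s x * timeDerivWithin S ζ s x * angVortQuot (v s) x ^ 2) +
          2 * ∫ x, ζ s x ^ 2 * angVortQuot (v s) x * Γ' s x) :=
    integral_cutoff_sq_sub_eq_of_ae_on (G := fun s x => angVortQuot (v s) x)
      (G' := Γ') hS hζ hK hsupp hWo hKW hΓcU hΓ'cU hderΓ ht.1 ht1S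
  obtain ⟨hdensJ, hbalJ⟩ : ContinuousOn (fun s => 2 * (∫ x, ζ s x * timeDerivWithin S ζ s x * radVelQuot (curl (v s)) x ^ 2) +
      2 * ∫ x, ζ s x ^ 2 * radVelQuot (curl (v s)) x * Φ' s x) S ∧
      (∫ x, (ζ t x * radVelQuot (curl (v t)) x) ^ 2) - (∫ x, (ζ t₁ x * radVelQuot (curl (v t₁)) x) ^ 2) =
        ∫ s in t₁..t, (2 * (∫ x, ζ s x * timeDerivWithin S ζ s x * radVelQuot (curl (v s)) x ^ 2) +
          2 * ∫ x, ζ s x ^ 2 * radVelQuot (curl (v s)) x * Φ' s x) :=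
    integral_cutoff_sq_sub_eq_of_ae_on (G := fun s x => radVelQuot (curl (v s)) x)
      (G' := Φ') hS hζ hK hsupp hWo hKW hJcU hΦ'cU hderJ ht.1 ht1S
  -- continuity of the dissipations
  have hΓd : ∀ s ∈ S, Differentiable ℝ (angVortQuot (v s)) := fun s hs =>
    (contDiff_angVortQuot (n := 1) ((hu s hs).of_le (by norm_cast))).differentiable one_ne_zero
  have hJd : ∀ s ∈ S, Differentiable ℝ (radVelQuot (curl (v s))) := fun s hs =>
    (contDiff_radVelQuot (n := 1) (contDiff_curl (n := 3) ((hu s hs).of_le (by norm_cast)))).differentiable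
      one_ne_zero
  have cDΓ : ContinuousOn (fun s => (∫ x, (fderiv ℝ (fun y => ζ s y * angVortQuot (v s) y) x (EuclideanSpace.single 0 1) ^ 2 + fderiv ℝ (fun y => ζ s y * angVortQuot (v s) y) x (EuclideanSpace.single 1 1) ^ 2 + fderiv ℝ (fun y => ζ s y * angVortQuot (v s) y) x (EuclideanSpace.single 2 1) ^ 2))) S :=
    continuousOn_integral_gradSq_cutoff_of_continuousOn (G := fun s x => angVortQuot (v s) x)
      hS hζ hK hsupp hΓcU hΓd hDΓc
  have cDJ : ContinuousOn (fun s => (∫ x, (fderiv ℝ (fun y => ζ s y * radVelQuot (curl (v s)) y) x (EuclideanSpace.single 0 1) ^ 2 + fderiv ℝ (fun y => ζ s y * radVelQuot (curl (v s)) y) x (EuclideanSpace.single 1 1) ^ 2 + fderiv ℝ (fun y => ζ s y * radVelQuot (curl (v s)) y) x (EuclideanSpace.single 2 1) ^ 2))) S :=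
    continuousOn_integral_gradSq_cutoff_of_continuousOn (G := fun s x => radVelQuot (curl (v s)) x)
      hS hζ hK hsupp hJcU hJd hDJc
  -- the pointwise-in-time inequality
  have hpt : ∀ s ∈ Icc t₁ t,
      (2 * (∫ x, ζ s x * timeDerivWithin S ζ s x * angVortQuot (v s) x ^ 2) +
        2 * ∫ x, ζ s x ^ 2 * angVortQuot (v s) x * Γ' s x) +
      (2 * (∫ x, ζ s x * timeDerivWithin S ζ s x * radVelQuot (curl (v s)) x ^ 2) +
        2 * ∫ x, ζ s x ^ 2 * radVelQuot (curl (v s)) x * Φ' s x) +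
      (2 * ν - 8 * C₁ / Real.log (Real.exp 1 / r₁) - θA) * ((∫ x, (fderiv ℝ (fun y => ζ s y * angVortQuot (v s) y) x (EuclideanSpace.single 0 1) ^ 2 + fderiv ℝ (fun y => ζ s y * angVortQuot (v s) y) x (EuclideanSpace.single 1 1) ^ 2 + fderiv ℝ (fun y => ζ s y * angVortQuot (v s) y) x (EuclideanSpace.single 2 1) ^ 2)) + (∫ x, (fderiv ℝ (fun y => ζ s y * radVelQuot (curl (v s)) y) x (EuclideanSpace.single 0 1) ^ 2 + fderiv ℝ (fun y => ζ s y * radVelQuot (curl (v s)) y) x (EuclideanSpace.single 1 1) ^ 2 + fderiv ℝ (fun y => ζ s y * radVelQuot (curl (v s)) y) x (EuclideanSpace.single 2 1) ^ 2))) ≤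
      Bcut + BA + 4 * M * volume.real (closedBall (0 : EuclideanSpace ℝ (Fin 3)) 2) := by
    intro s hs1
    have hs12 : s ∈ Icc t₁ t₂ := ⟨hs1.1, hs1.2.trans ht.2⟩
    have hs : s ∈ S := hsub hs12
    have hvs : ContDiff ℝ ∞ (v s) := hu s hs
    have hv2 : ContDiff ℝ 2 (v s) := hvs.of_le (by norm_cast)
    have hζ2 : ContDiff ℝ 2 (ζ s) := (hζ.contDiff_slice hs).of_le (by norm_cast)
    have hζ1 : ContDiff ℝ 1 (ζ s) := (hζ.contDiff_slice hs).of_le (by norm_cast)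
    have hζc : HasCompactSupport (ζ s) := HasCompactSupport.intro hK (hsupp s hs)
    have hΓ1 : ContDiff ℝ 1 (angVortQuot (v s)) := contDiff_angVortQuot (n := 1) (hvs.of_le (by norm_cast))
    have hJ1 : ContDiff ℝ 1 (radVelQuot (curl (v s))) :=
      contDiff_radVelQuot (n := 1) (contDiff_curl (n := 3) (hvs.of_le (by norm_cast)))
    have hdivs : ∀ x, ζ s x ≠ 0 → VectorCalculus.divergence (v s) x = 0 := fun x hx =>
      hdiv s hs x (hKW (by_contra fun h => hx (hsupp s hs x h)))
    -- fixed-time inequalities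
    have hfixΓ := angVortQuot_cutoff_energy_le_local (ν := ν) hvs (hax s hs) hν hζ2 (hζax s hs) hζc hdivs
    have hfixJ := radVelQuot_curl_cutoff_energy_le_local (ν := ν) hvs (hax s hs) hν hζ2 (hζax s hs) hζc hdivs
    have heΓ : (∫ x, ζ s x ^ 2 * angVortQuot (v s) x * Γ' s x) =
        ∫ x, ζ s x ^ 2 * angVortQuot (v s) x * angVelQuot (fun y => ν • (Δ (curl (v s))) y - fderiv ℝ (curl (v s)) y (v s y) + fderiv ℝ (v s) y (curl (v s) y)) x :=
      integral_congr_ae (Eventually.of_forall fun x => by simp only [hΓ'def])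
    have heJ : (∫ x, ζ s x ^ 2 * radVelQuot (curl (v s)) x * Φ' s x) =
        ∫ x, ζ s x ^ 2 * radVelQuot (curl (v s)) x * radVelQuot (fun y => ν • (Δ (curl (v s))) y - fderiv ℝ (curl (v s)) y (v s y) + fderiv ℝ (v s) y (curl (v s) y)) x :=
      integral_congr_ae (Eventually.of_forall fun x => by simp only [hΦ'def])
    -- the `B₃` bound
    have hfΓ : ContDiff ℝ 1 fun x => ζ s x * angVortQuot (v s) x := hζ1.mul hΓ1
    have hfJ : ContDiff ℝ 1 fun x => ζ s x * radVelQuot (curl (v s)) x := hζ1.mul hJ1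
    have hsΓ : tsupport (fun x => ζ s x * angVortQuot (v s) x) ⊆ SereginSverak2009.spaceCyl 0 1 :=
      tsupport_mul_subset_left.trans (hζs s hs)
    have hsJ : tsupport (fun x => ζ s x * radVelQuot (curl (v s)) x) ⊆ SereginSverak2009.spaceCyl 0 1 :=
      tsupport_mul_subset_left.trans (hζs s hs)
    have hB3 := abs_integral_angVelQuot_mul_mul_le (v s) _ _ C₁ r₁ M (hax s hs) hv2 hfΓ hfJ hsΓ hsJ
      hC₁ hr₁ hr₁1 hM (hσ s hs12) (hfar s hs12)
    have hB3eq : ∫ x, ζ s x ^ 2 * angVortQuot (v s) x * (angVelQuot (v s) x * radVelQuot (curl (v s)) x) =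
        ∫ x, angVelQuot (v s) x * (ζ s x * angVortQuot (v s) x) * (ζ s x * radVelQuot (curl (v s)) x) :=
      integral_congr_ae (Eventually.of_forall fun x => by ring)
    -- horizontal gradients are bounded by full gradients
    have hHΓ : ∫ x, (fderiv ℝ (fun y => ζ s y * angVortQuot (v s) y) x (EuclideanSpace.single 0 1) ^ 2 + fderiv ℝ (fun y => ζ s y * angVortQuot (v s) y) x (EuclideanSpace.single 1 1) ^ 2) ≤ (∫ x, (fderiv ℝ (fun y => ζ s y * angVortQuot (v s) y) x (EuclideanSpace.single 0 1) ^ 2 + fderiv ℝ (fun y => ζ s y * angVortQuot (v s) y) x (EuclideanSpace.single 1 1) ^ 2 + fderiv ℝ (fun y => ζ s y * angVortQuot (v s) y) x (EuclideanSpace.single 2 1) ^ 2)) :=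
      integral_horizontal_gradSq_le hfΓ (hζc.mul_right)
    have hHJ : ∫ x, (fderiv ℝ (fun y => ζ s y * radVelQuot (curl (v s)) y) x (EuclideanSpace.single 0 1) ^ 2 + fderiv ℝ (fun y => ζ s y * radVelQuot (curl (v s)) y) x (EuclideanSpace.single 1 1) ^ 2) ≤ (∫ x, (fderiv ℝ (fun y => ζ s y * radVelQuot (curl (v s)) y) x (EuclideanSpace.single 0 1) ^ 2 + fderiv ℝ (fun y => ζ s y * radVelQuot (curl (v s)) y) x (EuclideanSpace.single 1 1) ^ 2 + fderiv ℝ (fun y => ζ s y * radVelQuot (curl (v s)) y) x (EuclideanSpace.single 2 1) ^ 2)) :=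
      integral_horizontal_gradSq_le hfJ (hζc.mul_right)
    have hL₁0 : 0 < Real.log (Real.exp 1 / r₁) := by
      rw [log_exp_div_eq r₁ hr₁]; linarith [Real.log_neg hr₁ hr₁1]
    have hcoef : 0 ≤ 2 * C₁ / Real.log (Real.exp 1 / r₁) := by positivity
    have hB3' : |∫ x, angVelQuot (v s) x * (ζ s x * angVortQuot (v s) x) * (ζ s x * radVelQuot (curl (v s)) x)| ≤
        2 * C₁ / Real.log (Real.exp 1 / r₁) * ((∫ x, (fderiv ℝ (fun y => ζ s y * angVortQuot (v s) y) x (EuclideanSpace.single 0 1) ^ 2 + fderiv ℝ (fun y => ζ s y * angVortQuot (v s) y) x (EuclideanSpace.single 1 1) ^ 2 + fderiv ℝ (fun y => ζ s y * angVortQuot (v s) y) x (EuclideanSpace.single 2 1) ^ 2)) + (∫ x, (fderiv ℝ (fun y => ζ s y * radVelQuot (curl (v s)) y) x (EuclideanSpace.single 0 1) ^ 2 + fderiv ℝ (fun y => ζ s y * radVelQuot (curl (v s)) y) x (EuclideanSpace.single 1 1) ^ 2 + fderiv ℝ (fun y => ζ s y * radVelQuot (curl (v s)) y) x (EuclideanSpace.single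 2 1) ^ 2))) +
          M * volume.real (closedBall (0 : EuclideanSpace ℝ (Fin 3)) 2) := by
      refine hB3.trans ?_
      gcongr
    have habs := abs_le.1 hB3'
    have hcut' := hcut s hs12
    have hA3' := hA3 s hs12
    rw [hB3eq] at hfixΓ
    have h8 : 8 * C₁ / Real.log (Real.exp 1 / r₁) * ((∫ x, (fderiv ℝ (fun y => ζ s y * angVortQuot (v s) y) x (EuclideanSpace.single 0 1) ^ 2 + fderiv ℝ (fun y => ζ s y * angVortQuot (v s) y) x (EuclideanSpace.single 1 1) ^ 2 + fderiv ℝ (fun y => ζ s y * angVortQuot (v s) y) x (EuclideanSpace.single 2 1) ^ 2)) + (∫ x, (fderiv ℝ (fun y => ζ s y * radVelQuot (curl (v s)) y) x (EuclideanSpace.single 0 1) ^ 2 + fderiv ℝ (fun y => ζ s y * radVelQuot (curl (v s)) y) x (EuclideanSpace.single 1 1) ^ 2 + fderiv ℝ (fun y => ζ s y * radVelQuot (curl (v s)) y) x (EuclideanSpace.single 2 1) ^ 2))) =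
        4 * (2 * C₁ / Real.log (Real.exp 1 / r₁) * ((∫ x, (fderiv ℝ (fun y => ζ s y * angVortQuot (v s) y) x (EuclideanSpace.single 0 1) ^ 2 + fderiv ℝ (fun y => ζ s y * angVortQuot (v s) y) x (EuclideanSpace.single 1 1) ^ 2 + fderiv ℝ (fun y => ζ s y * angVortQuot (v s) y) x (EuclideanSpace.single 2 1) ^ 2)) + (∫ x, (fderiv ℝ (fun y => ζ s y * radVelQuot (curl (v s)) y) x (EuclideanSpace.single 0 1) ^ 2 + fderiv ℝ (fun y => ζ s y * radVelQuot (curl (v s)) y) x (EuclideanSpace.single 1 1) ^ 2 + fderiv ℝ (fun y => ζ s y * radVelQuot (curl (v s)) y) x (EuclideanSpace.single 2 1) ^ 2)))) := by ring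
    rw [heΓ, heJ]
    nlinarith [hfixΓ, hfixJ, habs.1, habs.2, hcut', hA3', h8]
  -- integrate over `[t₁, t]`
  have hIdensΓ := (hdensΓ.mono ht1S).intervalIntegrable_of_Icc (μ := volume) ht.1
  have hIdensJ := (hdensJ.mono ht1S).intervalIntegrable_of_Icc (μ := volume) ht.1
  have hID : IntervalIntegrable (fun s => (∫ x, (fderiv ℝ (fun y => ζ s y * angVortQuot (v s) y) x (EuclideanSpace.single 0 1) ^ 2 + fderiv ℝ (fun y => ζ s y * angVortQuot (v s) y) x (EuclideanSpace.single 1 1) ^ 2 + fderiv ℝ (fun y => ζ s y * angVortQuot (v s) y) x (EuclideanSpace.single 2 1) ^ 2)) + (∫ x, (fderiv ℝ (fun y => ζ s y * radVelQuot (curl (v s)) y) x (EuclideanSpace.single 0 1) ^ 2 + fderiv ℝ (fun y => ζ s y * radVelQuot (curl (v s)) y) x (EuclideanSpace.single 1 1) ^ 2 + fderiv ℝ (fun y => ζ s y * radVelQuot (curl (v s)) y) x (EuclideanSpace.single 2 1) ^ 2))) volume t₁ t :=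
    ((cDΓ.add cDJ).mono ht1S).intervalIntegrable_of_Icc (μ := volume) ht.1
  have hmono := intervalIntegral.integral_mono_on ht.1
    ((hIdensΓ.add hIdensJ).add (hID.const_mul (2 * ν - 8 * C₁ / Real.log (Real.exp 1 / r₁) - θA)))
    intervalIntegrable_const hpt
  rw [intervalIntegral.integral_add (hIdensΓ.add hIdensJ)
      (hID.const_mul (2 * ν - 8 * C₁ / Real.log (Real.exp 1 / r₁) - θA)),
    intervalIntegral.integral_add hIdensΓ hIdensJ, intervalIntegral.integral_const_mul,
    intervalIntegral.integral_const, smul_eq_mul] at hmono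
  linarith [hbalΓ, hbalJ, hmono]

/-- **Seregin 2022, §2 Step 3 — the key estimate, for the LOCAL smooth class** (arXiv p. 7:
"the key estimate can be derived by more or less standard arguments. It is as follows:
`sup_{-1<t<0}∫_𝒞 η⁶(|Γ|² + |Φ|²)dx + ∫_Q (η³|∇Φ|)² + (η³|∇Γ|)² dxdt ≤ C(v,η,r₁)`"). Under the
hypotheses of `cutoff_energy_apriori_local` and the smallness `8C₁/ln(e/r₁) + θ_A < 2ν`, with
`K₀ = E(t₁) + (Bcut + B_A + 4M|B(0,2)|)(t₂ − t₁)`: `sup_{t ∈ [t₁,t₂]} E(t) ≤ K₀` and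
`∫_{t₁}^{t₂} D ≤ K₀/(2ν − 8C₁/ln(e/r₁) − θ_A)` — verbatim the conclusion of the classical
`cutoff_energy_keyEstimate`. Registered sub-goal toward `stub_sereginLogSwirlOrigin`.
[cite: Seregin2022LocalAxisym, §2 Step 3 (arXiv:2201.00153 p. 7, the key estimate)] -/
theorem cutoff_energy_keyEstimate_local : ∀ (T₀ T₁ ν : ℝ) (v : ℝ → EuclideanSpace ℝ (Fin 3) → EuclideanSpace ℝ (Fin 3)) (ζ : ℝ → EuclideanSpace ℝ (Fin 3) → ℝ) (K W : Set (EuclideanSpace ℝ (Fin 3))) (t₁ t₂ C₁ r₁ M θA BA Bcut : ℝ), (∀ s ∈ Ioo T₀ T₁, ContDiff ℝ (⊤ : ℕ∞) (v s)) → (∀ s ∈ Ioo T₀ T₁, IsAxisymmetric (v s)) → 0 ≤ ν → IsSmoothSpaceTimeOn (Ioo T₀ T₁) ζ → (∀ s ∈ Ioo T₀ T₁, IsAxisymmetricScalar (ζ s)) → (∀ s ∈ Ioo T₀ T₁, tsupport (ζ s) ⊆ SereginSverak2009.spaceCyl 0 1) → Icc t₁ t₂ ⊆ Ioo T₀ T₁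 → IsCompact K → (∀ s ∈ Ioo T₀ T₁, ∀ x ∉ K, ζ s x = 0) → IsOpen W → K ⊆ W → (∀ s ∈ Ioo T₀ T₁, ∀ x ∈ W, VectorCalculus.divergence (v s) x = 0) → (∀ s ∈ Ioo T₀ T₁, ∀ x ∈ W, cylRadius x ≠ 0 → HasDerivAt (fun s' => curl (v s') x) (ν • (Δ (curl (v s))) x - fderiv ℝ (curl (v s)) x (v s x) + fderiv ℝ (v s) x (curl (v s) x)) s) → ContinuousOn (fun z : ℝ × EuclideanSpace ℝ (Fin 3) => angVortQuot (v z.1) z.2) (Ioo T₀ T₁ ×ˢ univ) → ContinuousOn (fun z : ℝ × EuclideanSpace ℝ (Fin 3) => angVelQuot (fun y => ν • (Δ (curl (v z.1))) y - fderiv ℝ (curl (v z.1)) y (v z.1 y) + fderiv ℝ (v z.1) y (curl (v z.1) y)) z.2) (Ioo T₀ T₁ ×ˢ univ) → ContinuousOn (fun z : ℝ × EuclideanSpace ℝ (Fin 3) => fderiv ℝ (angVortQuot (v z.1)) z.2) (Ioo T₀ T₁ ×ˢ univ) → ContinuousOn (fun z : ℝ × EuclideanSpace ℝ (Fin 3)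 => radVelQuot (curl (v z.1)) z.2) (Ioo T₀ T₁ ×ˢ univ) → ContinuousOn (fun z : ℝ × EuclideanSpace ℝ (Fin 3) => radVelQuot (fun y => ν • (Δ (curl (v z.1))) y - fderiv ℝ (curl (v z.1)) y (v z.1 y) + fderiv ℝ (v z.1) y (curl (v z.1) y)) z.2) (Ioo T₀ T₁ ×ˢ univ) → ContinuousOn (fun z : ℝ × EuclideanSpace ℝ (Fin 3) => fderiv ℝ (radVelQuot (curl (v z.1))) z.2) (Ioo T₀ T₁ ×ˢ univ) → 0 ≤ C₁ → 0 < r₁ → r₁ < 1 → 0 ≤ M → (∀ t ∈ Icc t₁ t₂, ∀ x, 0 < cylRadius x → cylRadius x < r₁ → |swirl (v t) x| ≤ C₁ / Real.log (Real.exp 1 / cylRadius x) ^ 3) → (∀ t ∈ Icc t₁ t₂, ∀ x, r₁ ≤ cylRadius x → |angVelQuot (v t) x * (ζ t x * angVortQuot (v t) x) * (ζ t x * radVelQuot (curl (v t)) x)| ≤ M) → (∀ t ∈ Icc t₁ t₂, (2 * (∫ x, ζ t x * timeDerivWithin (Ioo T₀ T₁) ζ t x * angVortQuot (v t) x ^ 2)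 + 2 * (∫ x, ζ t x * angVortQuot (v t) x ^ 2 * fderiv ℝ (ζ t) x (v t x)) + 2 * ν * (∫ x, angVortQuot (v t) x ^ 2 * (fderiv ℝ (ζ t) x (EuclideanSpace.single 0 1) ^ 2 + fderiv ℝ (ζ t) x (EuclideanSpace.single 1 1) ^ 2 + fderiv ℝ (ζ t) x (EuclideanSpace.single 2 1) ^ 2)) - 4 * ν * (∫ x, ζ t x * angVortQuot (v t) x ^ 2 * radDerivQuot (ζ t) x)) + (2 * (∫ x, ζ t x * timeDerivWithin (Ioo T₀ T₁) ζ t x * radVelQuot (curl (v t)) x ^ 2) + 2 * (∫ x, ζ t x * radVelQuot (curl (v t)) x ^ 2 * fderiv ℝ (ζ t) x (v t x)) + 2 * ν * (∫ x, radVelQuot (curl (v t)) x ^ 2 * (fderiv ℝ (ζ t) x (EuclideanSpace.single 0 1) ^ 2 + fderiv ℝ (ζ t) x (EuclideanSpace.single 1 1) ^ 2 + fderiv ℝ (ζ t) x (EuclideanSpace.single 2 1) ^ 2)) - 4 * ν * (∫ x, ζ t x * radVelQuot (curl (v t)) x ^ 2 * radDerivQuot (ζ t) x)) ≤ Bcut)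 → (∀ t ∈ Icc t₁ t₂, 2 * (∫ x, ζ t x ^ 2 * radVelQuot (curl (v t)) x * fderiv ℝ (radVelQuot (v t)) x (curl (v t) x)) ≤ θA * ((∫ x, (fderiv ℝ (fun y => ζ t y * angVortQuot (v t) y) x (EuclideanSpace.single 0 1) ^ 2 + fderiv ℝ (fun y => ζ t y * angVortQuot (v t) y) x (EuclideanSpace.single 1 1) ^ 2 + fderiv ℝ (fun y => ζ t y * angVortQuot (v t) y) x (EuclideanSpace.single 2 1) ^ 2)) + (∫ x, (fderiv ℝ (fun y => ζ t y * radVelQuot (curl (v t)) y) x (EuclideanSpace.single 0 1) ^ 2 + fderiv ℝ (fun y => ζ t y * radVelQuot (curl (v t)) y) x (EuclideanSpace.single 1 1) ^ 2 + fderiv ℝ (fun y => ζ t y * radVelQuot (curl (v t)) y) x (EuclideanSpace.single 2 1) ^ 2))) + BA) → 0 ≤ Bcut → 0 ≤ BA → 8 * C₁ / Real.log (Real.exp 1 / r₁) + θA < 2 * ν → t₁ ≤ t₂ → (∀ t ∈ Icc t₁ t₂, (∫ x, (ζ t x * angVortQuot (v t) x) ^ 2) + (∫ x, (ζ t x * radVelQuot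 (curl (v t)) x) ^ 2) ≤ (∫ x, (ζ t₁ x * angVortQuot (v t₁) x) ^ 2) + (∫ x, (ζ t₁ x * radVelQuot (curl (v t₁)) x) ^ 2) + (Bcut + BA + 4 * M * volume.real (closedBall (0 : EuclideanSpace ℝ (Fin 3)) 2)) * (t₂ - t₁)) ∧ ∫ s in t₁..t₂, ((∫ x, (fderiv ℝ (fun y => ζ s y * angVortQuot (v s) y) x (EuclideanSpace.single 0 1) ^ 2 + fderiv ℝ (fun y => ζ s y * angVortQuot (v s) y) x (EuclideanSpace.single 1 1) ^ 2 + fderiv ℝ (fun y => ζ s y * angVortQuot (v s) y) x (EuclideanSpace.single 2 1) ^ 2)) + (∫ x, (fderiv ℝ (fun y => ζ s y * radVelQuot (curl (v s)) y) x (EuclideanSpace.single 0 1) ^ 2 + fderiv ℝ (fun y => ζ s y * radVelQuot (curl (v s)) y) x (EuclideanSpace.single 1 1) ^ 2 + fderiv ℝ (fun y => ζ s y * radVelQuot (curl (v s)) y) x (EuclideanSpace.single 2 1) ^ 2))) ≤ ((∫ x, (ζ t₁ x * angVortQuot (v t₁) x) ^ 2) + (∫ x, (ζ t₁ x * radVelQuot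 (curl (v t₁)) x) ^ 2) + (Bcut + BA + 4 * M * volume.real (closedBall (0 : EuclideanSpace ℝ (Fin 3)) 2)) * (t₂ - t₁)) / (2 * ν - 8 * C₁ / Real.log (Real.exp 1 / r₁) - θA) := by
  intro T₀ T₁ ν v ζ K W t₁ t₂ C₁ r₁ M θA BA Bcut hu hax hν hζ hζax hζs hsub hK hsupp hWo hKW hdiv hvort hΓc hΓ'c hDΓc hJc hJ'c hDJc hC₁ hr₁ hr₁1 hM hσ hfar hcut hA3 hBcut hBA hsmall h12
  have hap := cutoff_energy_apriori_local T₀ T₁ ν v ζ K W t₁ t₂ C₁ r₁ M θA BA Bcut hu hax hν hζ hζax hζs hsub hK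
    hsupp hWo hKW hdiv hvort hΓc hΓ'c hDΓc hJc hJ'c hDJc hC₁ hr₁ hr₁1 hM hσ hfar hcut hA3
  have hVOL : 0 ≤ volume.real (closedBall (0 : EuclideanSpace ℝ (Fin 3)) 2) := measureReal_nonneg
  have hB : 0 ≤ Bcut + BA + 4 * M * volume.real (closedBall (0 : EuclideanSpace ℝ (Fin 3)) 2) := by positivity
  have hpos : 0 < 2 * ν - 8 * C₁ / Real.log (Real.exp 1 / r₁) - θA := by linarith
  have hDnn : ∀ s, 0 ≤ (∫ x, (fderiv ℝ (fun y => ζ s y * angVortQuot (v s) y) x (EuclideanSpace.single 0 1) ^ 2 + fderiv ℝ (fun y => ζ s y * angVortQuot (v s) y) x (EuclideanSpace.single 1 1) ^ 2 + fderiv ℝ (fun y => ζ s y * angVortQuot (v s) y) x (EuclideanSpace.single 2 1) ^ 2)) + (∫ x, (fderiv ℝ (fun y => ζ s y * radVelQuot (curl (v s)) y) x (EuclideanSpace.single 0 1) ^ 2 + fderiv ℝ (fun y => ζ s y * radVelQuot (curl (v s)) y) x (EuclideanSpace.single 1 1) ^ 2 + fderiv ℝ (fun y => ζ s y * radVelQuot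 (curl (v s)) y) x (EuclideanSpace.single 2 1) ^ 2)) := fun s =>
    add_nonneg (integral_nonneg fun x => by positivity) (integral_nonneg fun x => by positivity)
  have hIDnn : ∀ t, t₁ ≤ t → 0 ≤ ∫ s in t₁..t, ((∫ x, (fderiv ℝ (fun y => ζ s y * angVortQuot (v s) y) x (EuclideanSpace.single 0 1) ^ 2 + fderiv ℝ (fun y => ζ s y * angVortQuot (v s) y) x (EuclideanSpace.single 1 1) ^ 2 + fderiv ℝ (fun y => ζ s y * angVortQuot (v s) y) x (EuclideanSpace.single 2 1) ^ 2)) + (∫ x, (fderiv ℝ (fun y => ζ s y * radVelQuot (curl (v s)) y) x (EuclideanSpace.single 0 1) ^ 2 + fderiv ℝ (fun y => ζ s y * radVelQuot (curl (v s)) y) x (EuclideanSpace.single 1 1) ^ 2 + fderiv ℝ (fun y => ζ s y * radVelQuot (curl (v s)) y) x (EuclideanSpace.single 2 1) ^ 2))) := fun t ht =>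
    intervalIntegral.integral_nonneg ht fun s _ => hDnn s
  refine ⟨fun t ht => ?_, ?_⟩
  · have h := hap t ht
    have h1 : (Bcut + BA + 4 * M * volume.real (closedBall (0 : EuclideanSpace ℝ (Fin 3)) 2)) * (t - t₁) ≤ (Bcut + BA + 4 * M * volume.real (closedBall (0 : EuclideanSpace ℝ (Fin 3)) 2)) * (t₂ - t₁) :=
      mul_le_mul_of_nonneg_left (by linarith [ht.2]) hB
    nlinarith [hIDnn t ht.1, mul_nonneg hpos.le (hIDnn t ht.1)]
  · have h := hap t₂ ⟨h12, le_rfl⟩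
    have hE : 0 ≤ (∫ x, (ζ t₂ x * angVortQuot (v t₂) x) ^ 2) + (∫ x, (ζ t₂ x * radVelQuot (curl (v t₂)) x) ^ 2) :=
      add_nonneg (integral_nonneg fun x => by positivity) (integral_nonneg fun x => by positivity)
    rw [le_div_iff₀ hpos]
    nlinarith [hIDnn t₂ h12]

end Apriori

end Summit.NavierStokesRegularity.NavierStokesRegularity.Theorems.AxisymmetricKatoGlobal.EulerScaling

end
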